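import Summits.BirchSwinnertonDyer.BirchSwinnertonDyer.Theorems.ErratumRoadFiveRest3DWitnessD1VisibleKernel
import Summits.BirchSwinnertonDyer.BirchSwinnertonDyer.Theorems.ErratumRoadFiveRest3DWitnessD2RankKernel
import Summits.BirchSwinnertonDyer.Rank1Residual.GaloisImage.LocalThreeTorsionAdicCompletionAt
import Summits.BirchSwinnertonDyer.Rank1Residual.Additive.AdicIntegersQuotientPrimePowCard
import Literature.NumberTheory.EllipticCurves.LutzNagellGeneralWeierstrass
import HarnessLib

/-!
# Route `SemiOrdinaryEisensteinDescent`, crux #2″ `WildSplitEisensteinValueAtOneV` (E_𝟙^V, stmt-BirchSwinnertonDyer-26610):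
# the VISIBILITY PARTNER of the content row `441099r1` — `F = 147033a1 = [0, 0, 1, −651, 6502]` has Mordell–Weil rank `≥ 3`, IN THE KERNEL
# (cell `pub/bsd-wall`, width seat `bsd-wall-soed-p1-w3` g20; `--supports stmt-BirchSwinnertonDyer-26610`; THEOREMS ONLY; Theses-FREE)

WHY. Modulo print and the rank-zero leaf Z, crux #2″ is «`Typed.MissingLowerBoundAt W 3` on the cell» (w3 g14); in Cremona's range its
content is nine curves with `#Ш_an = 9`, each `3`-congruent to a RANK-3 curve at lower `3`-level (memo
`Cruxes/WildSplitEisensteinInclusionAtThree/E1V-VISIBLE-NINE-w3g20.md`). The visibility door for analytic rank one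
(`VisibleLowerHalf.missingLowerBoundAt_of_congr_of_places_of_analyticRank_one`) must PAY the place above `3` (the cell curve is additive
there), so the count `3^{rank E}·#F(ℚ₃)[3]·#(ℤ₃/3) < 3^{rank F}` needs a partner of rank THREE. This file certifies `3 ≤ rank F(ℚ)` for the
partner `F = 147033a1` (`N′ = 3²·17·31² = N/3`, `Δ′ = −3⁷·17²·31²`, the ℤ-basis `P₁ = (25,76)`, `P₂ = (−26,76)`, `P₃ = (−17,112)` of
`F(ℚ)` = Cremona's generators with the third, `(49/4, 149/8)`, replaced by its sum with the first) by the tree's kernel `3`-descent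
(`Rank2.linearIndependent_triple_of_three_descent`, pattern of `ErratumRoadFiveRest3DWitnessD2RankKernel.lean`): reductions at the good
primes `7` (`#F̃ = 12`, nine representatives of `ℙ²(𝔽₃)`, multiplier `4`), `11` (`#F̃ = 18`, three, multiplier `6`), `29` (`#F̃ = 30`, one,
multiplier `10`), no rational `3`-torsion by `5` (`#F̃ = 8`); all point identities decided by `decide +kernel` on Mathlib's group law over
`ZMod ℓ`. Third kernel record of the seat's VISIBLE-NINE instrument; the companion file `…Visible441099r1.lean` consumes `three_le_rank_F`.

HONEST FRAMING: THEOREMS ONLY (no definition, no named fact, no `sorry`); statements about ONE explicit curve; closes nothing; BSD is not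
proved by any of this.

References: [SilvermanAEC2009] III.1, VII.2.1, VII.3.1(b), VIII.6.7; Cassels, *Lectures on Elliptic Curves* §13 [folklore];
[CremonaMazur2000] §3; Cremona's `ecdata` (147033a1: `allcurves`/`allgens`).
-/

-- the Theorems namespace of this sub repeats the summit name by design (D-0017 nested layout)
set_option linter.dupNamespace false
set_option autoImplicit false

noncomputable section

open scoped Classical

open WeierstrassCurve IsDedekindDomain NumberField Rat.HeightOneSpectrum
  Literature.NumberTheory.EllipticCurves Literature.NumberTheory.EllipticCurves.Rank1Residual
  Literature.NumberTheory.EllipticCurves.Rank1Residual.Typed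
  Literature.NumberTheory.EllipticCurves.Rank1Residual.X11RankOneCertificates
  Summit.BirchSwinnertonDyer.BirchSwinnertonDyer.Rank1Residual.IntModel
  Summit.BirchSwinnertonDyer.Rank1Residual Summit.BirchSwinnertonDyer.Rank1Residual.X11b
  Summit.BirchSwinnertonDyer.Rank1Residual.Supersingular
  Summit.BirchSwinnertonDyer.Rank1Residual.GaloisImage
  Summit.BirchSwinnertonDyer.Rank2

namespace Summit.BirchSwinnertonDyer.BirchSwinnertonDyer.Theorems

namespace Visible441099r1

open VisiblePlaces D1VisibleKernel

/-! ## The partner `F = 147033a1 = [0, 0, 1, −651, 6502]`: model, three points, `3 ≤ rank F(ℚ)` by a `3`-descent in the kernel -/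

/-- `Δ(F) = −607393323 = −3⁷·17²·31²`. [folklore] -/
theorem F_Δ : (⟨0, 0, 1, -651, 6502⟩ : WeierstrassCurve ℤ).Δ = -607393323 := by decide

/-- `c₄(F) = 31248` (prime to `17`). [folklore] -/
theorem F_c₄ : (⟨0, 0, 1, -651, 6502⟩ : WeierstrassCurve ℤ).c₄ = 31248 := by decide

/-- The rational model of `F` is the base change of the integer one. [folklore] -/
theorem F_map_eq : (⟨0, 0, 1, -651, 6502⟩ : WeierstrassCurve ℤ).map (Int.castRingHom ℚ) = (⟨0, 0, 1, -651, 6502⟩ : WeierstrassCurve ℚ) := by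
  ext <;> simp [WeierstrassCurve.map]

/-- The same in `baseChange` form. [folklore] -/
theorem F_baseChange_eq : (⟨0, 0, 1, -651, 6502⟩ : WeierstrassCurve ℤ).baseChange ℚ = (⟨0, 0, 1, -651, 6502⟩ : WeierstrassCurve ℚ) :=
  F_map_eq

/-- `Δ(F/ℚ) ≠ 0`. [folklore] -/
theorem F_map_Δ_ne_zero : ((⟨0, 0, 1, -651, 6502⟩ : WeierstrassCurve ℤ).map (Int.castRingHom ℚ)).Δ ≠ 0 := by
  rw [WeierstrassCurve.map_Δ, F_Δ]; norm_num

/-- `F/ℚ` is an elliptic curve. [folklore] -/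
theorem isElliptic_F : (⟨0, 0, 1, -651, 6502⟩ : WeierstrassCurve ℚ).IsElliptic :=
  isElliptic_of_discOf_ne_zero 0 0 1 (-651) 6502 (by decide +kernel)

/-- `P₁ = (25, 76)` lies on `F`. [folklore] -/
theorem nonsingular_P₁ : ((⟨0, 0, 1, -651, 6502⟩ : WeierstrassCurve ℤ).map (Int.castRingHom ℚ)).toAffine.Nonsingular ((25 : ℤ) : ℚ) ((76 : ℤ) : ℚ) :=
  (Affine.equation_iff_nonsingular_of_Δ_ne_zero F_map_Δ_ne_zero).mp (by rw [F_map_eq, Affine.equation_iff]; norm_num)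

/-- `P₂ = (−26, 76)` lies on `F`. [folklore] -/
theorem nonsingular_P₂ : ((⟨0, 0, 1, -651, 6502⟩ : WeierstrassCurve ℤ).map (Int.castRingHom ℚ)).toAffine.Nonsingular ((-26 : ℤ) : ℚ) ((76 : ℤ) : ℚ) :=
  (Affine.equation_iff_nonsingular_of_Δ_ne_zero F_map_Δ_ne_zero).mp (by rw [F_map_eq, Affine.equation_iff]; norm_num)

/-- `P₃ = (−17, 112)` (= Cremona's third generator `(49/4, 149/8)` plus `P₁`) lies on `F`. [folklore] -/
theorem nonsingular_P₃ : ((⟨0, 0, 1, -651, 6502⟩ : WeierstrassCurve ℤ).map (Int.castRingHom ℚ)).toAffine.Nonsingular ((-17 : ℤ) : ℚ) ((112 : ℤ) : ℚ) :=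
  (Affine.equation_iff_nonsingular_of_Δ_ne_zero F_map_Δ_ne_zero).mp (by rw [F_map_eq, Affine.equation_iff]; norm_num)

/-- `5, 7, 11, 29` are good primes of `F`. [folklore] -/
theorem F_good_primes :
    ¬ ((5 : ℤ) ∣ (⟨0, 0, 1, -651, 6502⟩ : WeierstrassCurve ℤ).Δ) ∧ ¬ ((7 : ℤ) ∣ (⟨0, 0, 1, -651, 6502⟩ : WeierstrassCurve ℤ).Δ) ∧
    ¬ ((11 : ℤ) ∣ (⟨0, 0, 1, -651, 6502⟩ : WeierstrassCurve ℤ).Δ) ∧ ¬ ((29 : ℤ) ∣ (⟨0, 0, 1, -651, 6502⟩ : WeierstrassCurve ℤ).Δ) := by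
  rw [F_Δ]; norm_num

/-- The reduction of `F` at a good prime `ℓ` with the images of `P₁, P₂, P₃` (tree `intModel_exists_reductionHom`).
[cite: SilvermanAEC2009, Prop. VII.2.1] -/
theorem F_exists_red (ℓ : ℕ) [Fact ℓ.Prime] (hΔ : ¬ ((ℓ : ℤ) ∣ (⟨0, 0, 1, -651, 6502⟩ : WeierstrassCurve ℤ).Δ)) :
    ∃ red : ((⟨0, 0, 1, -651, 6502⟩ : WeierstrassCurve ℤ).map (Int.castRingHom ℚ)).toAffine.Point →+
        ((⟨0, 0, 1, -651, 6502⟩ : WeierstrassCurve ℤ).map (Int.castRingHom (ZMod ℓ))).toAffine.Point,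
      (∀ (n : ℤ), ¬ ((ℓ : ℤ) ∣ n) → ∀ P : ((⟨0, 0, 1, -651, 6502⟩ : WeierstrassCurve ℤ).map (Int.castRingHom ℚ)).toAffine.Point,
          n • P = 0 → red P = 0 → P = 0) ∧
      red (.some _ _ nonsingular_P₁) = .some _ _ (intModel_nonsingular_reduce _ ℓ hΔ 25 76 nonsingular_P₁) ∧
      red (.some _ _ nonsingular_P₂) = .some _ _ (intModel_nonsingular_reduce _ ℓ hΔ (-26) 76 nonsingular_P₂) ∧
      red (.some _ _ nonsingular_P₃) = .some _ _ (intModel_nonsingular_reduce _ ℓ hΔ (-17) 112 nonsingular_P₃) := by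
  obtain ⟨red, hsome, hinj⟩ := intModel_exists_reductionHom (⟨0, 0, 1, -651, 6502⟩ : WeierstrassCurve ℤ) ℓ hΔ
  exact ⟨red, hinj, hsome 25 76 _ _, hsome (-26) 76 _ _, hsome (-17) 112 _ _⟩

/-- `#F̃(𝔽₅) = 8` (kernel-decided; prime to `3`). [folklore] -/
theorem card_F_5 : Nat.card (((⟨0, 0, 1, -651, 6502⟩ : WeierstrassCurve ℤ).map (Int.castRingHom (ZMod 5))).toAffine.Point) = 8 := by
  rw [@WeierstrassCurve.natCard_point_eq_one_add_card (ZMod 5) (@ZMod.instField 5 ⟨by norm_num⟩) _ _ _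
    (by decide +kernel), @card_sol_eq_sum_euler (ZMod 5) (@ZMod.instField 5 ⟨by norm_num⟩) _ _
    (by rw [ZMod.ringChar_zmod_n]; decide), ZMod.card]
  decide +kernel

/-- `#F̃(𝔽₇) = 12` (kernel-decided). [folklore] -/
theorem card_F_7 : Nat.card (((⟨0, 0, 1, -651, 6502⟩ : WeierstrassCurve ℤ).map (Int.castRingHom (ZMod 7))).toAffine.Point) = 12 := by
  rw [@WeierstrassCurve.natCard_point_eq_one_add_card (ZMod 7) (@ZMod.instField 7 ⟨by norm_num⟩) _ _ _
    (by decide +kernel), @card_sol_eq_sum_euler (ZMod 7) (@ZMod.instField 7 ⟨by norm_num⟩) _ _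
    (by rw [ZMod.ringChar_zmod_n]; decide), ZMod.card]
  decide +kernel

/-- `#F̃(𝔽₁₁) = 18` (kernel-decided). [folklore] -/
theorem card_F_11 : Nat.card (((⟨0, 0, 1, -651, 6502⟩ : WeierstrassCurve ℤ).map (Int.castRingHom (ZMod 11))).toAffine.Point) = 18 := by
  rw [@WeierstrassCurve.natCard_point_eq_one_add_card (ZMod 11) (@ZMod.instField 11 ⟨by norm_num⟩) _ _ _
    (by decide +kernel), @card_sol_eq_sum_euler (ZMod 11) (@ZMod.instField 11 ⟨by norm_num⟩) _ _
    (by rw [ZMod.ringChar_zmod_n]; decide), ZMod.card]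
  decide +kernel

/-- `#F̃(𝔽₂₉) = 30` (kernel-decided). [folklore] -/
theorem card_F_29 : Nat.card (((⟨0, 0, 1, -651, 6502⟩ : WeierstrassCurve ℤ).map (Int.castRingHom (ZMod 29))).toAffine.Point) = 30 := by
  rw [@WeierstrassCurve.natCard_point_eq_one_add_card (ZMod 29) (@ZMod.instField 29 ⟨by norm_num⟩) _ _ _
    (by decide +kernel), @card_sol_eq_sum_euler (ZMod 29) (@ZMod.instField 29 ⟨by norm_num⟩) _ _
    (by rw [ZMod.ringChar_zmod_n]; decide), ZMod.card]
  decide +kernel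

/-- **The `𝔽₇` certificates** (`#F̃(𝔽₇) = 12`, test multiplier `4`): `4·ū ≠ Õ` for the representatives
`P₁`, `P₂`, `P₃`, `P₁ + P₂`, `P₁ + 2 • P₃`, `P₂ + 2 • P₃`, `P₁ + P₂ + P₃`, `P₁ + 2 • P₂ + P₃`, `P₁ + 2 • P₂ + 2 • P₃` (kernel-decided). [folklore] -/
theorem cert_F_7 [Fact (Nat.Prime 7)] :
    let P₁ : ((⟨0, 0, 1, -651, 6502⟩ : WeierstrassCurve ℤ).map (Int.castRingHom (ZMod 7))).toAffine.Point :=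
      .some _ _ (intModel_nonsingular_reduce _ 7 F_good_primes.2.1 25 76 nonsingular_P₁)
    let P₂ : ((⟨0, 0, 1, -651, 6502⟩ : WeierstrassCurve ℤ).map (Int.castRingHom (ZMod 7))).toAffine.Point :=
      .some _ _ (intModel_nonsingular_reduce _ 7 F_good_primes.2.1 (-26) 76 nonsingular_P₂)
    let P₃ : ((⟨0, 0, 1, -651, 6502⟩ : WeierstrassCurve ℤ).map (Int.castRingHom (ZMod 7))).toAffine.Point :=
      .some _ _ (intModel_nonsingular_reduce _ 7 F_good_primes.2.1 (-17) 112 nonsingular_P₃)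
    (4 : ℕ) • P₁ ≠ 0 ∧
    (4 : ℕ) • P₂ ≠ 0 ∧
    (4 : ℕ) • P₃ ≠ 0 ∧
    (4 : ℕ) • (P₁ + P₂) ≠ 0 ∧
    (4 : ℕ) • (P₁ + 2 • P₃) ≠ 0 ∧
    (4 : ℕ) • (P₂ + 2 • P₃) ≠ 0 ∧
    (4 : ℕ) • (P₁ + P₂ + P₃) ≠ 0 ∧
    (4 : ℕ) • (P₁ + 2 • P₂ + P₃) ≠ 0 ∧
    (4 : ℕ) • (P₁ + 2 • P₂ + 2 • P₃) ≠ 0 := by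
  intro P₁ P₂ P₃
  refine ⟨?_, ?_, ?_, ?_, ?_, ?_, ?_, ?_, ?_⟩ <;> decide +kernel +revert

/-- **The `𝔽₁₁` certificates** (`#F̃(𝔽₁₁) = 18`, test multiplier `6`): `6·ū ≠ Õ` for `P₁ + 2 • P₂`, `P₁ + P₃`, `P₂ + P₃`
(kernel-decided). [folklore] -/
theorem cert_F_11 [Fact (Nat.Prime 11)] :
    let P₁ : ((⟨0, 0, 1, -651, 6502⟩ : WeierstrassCurve ℤ).map (Int.castRingHom (ZMod 11))).toAffine.Point :=
      .some _ _ (intModel_nonsingular_reduce _ 11 F_good_primes.2.2.1 25 76 nonsingular_P₁)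
    let P₂ : ((⟨0, 0, 1, -651, 6502⟩ : WeierstrassCurve ℤ).map (Int.castRingHom (ZMod 11))).toAffine.Point :=
      .some _ _ (intModel_nonsingular_reduce _ 11 F_good_primes.2.2.1 (-26) 76 nonsingular_P₂)
    let P₃ : ((⟨0, 0, 1, -651, 6502⟩ : WeierstrassCurve ℤ).map (Int.castRingHom (ZMod 11))).toAffine.Point :=
      .some _ _ (intModel_nonsingular_reduce _ 11 F_good_primes.2.2.1 (-17) 112 nonsingular_P₃)
    (6 : ℕ) • (P₁ + 2 • P₂) ≠ 0 ∧
    (6 : ℕ) • (P₁ + P₃) ≠ 0 ∧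
    (6 : ℕ) • (P₂ + P₃) ≠ 0 := by
  intro P₁ P₂ P₃
  refine ⟨?_, ?_, ?_⟩ <;> decide +kernel +revert

/-- **The `𝔽₂₉` certificate** (`#F̃(𝔽₂₉) = 30`, test multiplier `10`): `10·(P̄₁ + P̄₂ + 2P̄₃) ≠ Õ` (kernel-decided). [folklore] -/
theorem cert_F_29 [Fact (Nat.Prime 29)] :
    let P₁ : ((⟨0, 0, 1, -651, 6502⟩ : WeierstrassCurve ℤ).map (Int.castRingHom (ZMod 29))).toAffine.Point :=
      .some _ _ (intModel_nonsingular_reduce _ 29 F_good_primes.2.2.2 25 76 nonsingular_P₁)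
    let P₂ : ((⟨0, 0, 1, -651, 6502⟩ : WeierstrassCurve ℤ).map (Int.castRingHom (ZMod 29))).toAffine.Point :=
      .some _ _ (intModel_nonsingular_reduce _ 29 F_good_primes.2.2.2 (-26) 76 nonsingular_P₂)
    let P₃ : ((⟨0, 0, 1, -651, 6502⟩ : WeierstrassCurve ℤ).map (Int.castRingHom (ZMod 29))).toAffine.Point :=
      .some _ _ (intModel_nonsingular_reduce _ 29 F_good_primes.2.2.2 (-17) 112 nonsingular_P₃)
    (10 : ℕ) • (P₁ + P₂ + 2 • P₃) ≠ 0 := by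
  intro P₁ P₂ P₃
  decide +kernel +revert

/-- **`F(ℚ)` has no `3`-torsion**: reduction at the good prime `5` is injective on prime-to-`5` torsion and `#F̃(𝔽₅) = 8` is prime to `3`.
[cite: SilvermanAEC2009, Prop. VII.3.1(b)] -/
theorem F_no_three_torsion (x : ((⟨0, 0, 1, -651, 6502⟩ : WeierstrassCurve ℤ).map (Int.castRingHom ℚ)).toAffine.Point)
    (hx : (3 : ℤ) • x = 0) : x = 0 := by
  haveI : Fact (Nat.Prime 5) := ⟨by norm_num⟩
  obtain ⟨red, hinj, -, -, -⟩ := F_exists_red 5 F_good_primes.1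
  refine hinj 3 (by decide) x hx ?_
  have hx' : (3 : ℕ) • x = 0 := by rw [ofNat_zsmul] at hx; exact hx
  have h3 : addOrderOf (red x) ∣ 3 := by
    rw [addOrderOf_dvd_iff_nsmul_eq_zero, ← map_nsmul, hx', map_zero]
  have h8 : addOrderOf (red x) ∣ 8 := card_F_5 ▸ addOrderOf_dvd_natCard (red x)
  have h1 : addOrderOf (red x) ∣ Nat.gcd 3 8 := Nat.dvd_gcd h3 h8
  norm_num at h1
  exact h1

/-- **`P₁, P₂, P₃` are `ℤ`-linearly independent in `F(ℚ)`**: the `3`-descent certificate on the reductions at `7` (nine representatives,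
multiplier `4`), `11` (three, multiplier `6`) and `29` (one, multiplier `10`); no `3`-torsion by `5`.
[cite: SilvermanAEC2009, Prop. VII.2.1 and Thm. VIII.6.7] -/
theorem F_linearIndependent :
    LinearIndependent ℤ
      ![(Affine.Point.some _ _ nonsingular_P₁ : ((⟨0, 0, 1, -651, 6502⟩ : WeierstrassCurve ℤ).map (Int.castRingHom ℚ)).toAffine.Point),
        Affine.Point.some _ _ nonsingular_P₂, Affine.Point.some _ _ nonsingular_P₃] := by
  haveI : Fact (Nat.Prime 7) := ⟨by norm_num⟩
  haveI : Fact (Nat.Prime 11) := ⟨by norm_num⟩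
  haveI : Fact (Nat.Prime 29) := ⟨by norm_num⟩
  obtain ⟨r7, -, h7a, h7b, h7c⟩ := F_exists_red 7 F_good_primes.2.1
  obtain ⟨r11, -, h11a, h11b, h11c⟩ := F_exists_red 11 F_good_primes.2.2.1
  obtain ⟨r29, -, h29a, h29b, h29c⟩ := F_exists_red 29 F_good_primes.2.2.2
  obtain ⟨c100, c010, c001, c110, c102, c012, c111, c121, c122⟩ := cert_F_7
  obtain ⟨c120, c101, c011⟩ := cert_F_11
  have c112 := cert_F_29
  have d7 : 3 ∣ Nat.card (((⟨0, 0, 1, -651, 6502⟩ : WeierstrassCurve ℤ).map (Int.castRingHom (ZMod 7))).toAffine.Point) := by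
    rw [card_F_7]; norm_num
  have d11 : 3 ∣ Nat.card (((⟨0, 0, 1, -651, 6502⟩ : WeierstrassCurve ℤ).map (Int.castRingHom (ZMod 11))).toAffine.Point) := by
    rw [card_F_11]; norm_num
  have d29 : 3 ∣ Nat.card (((⟨0, 0, 1, -651, 6502⟩ : WeierstrassCurve ℤ).map (Int.castRingHom (ZMod 29))).toAffine.Point) := by
    rw [card_F_29]; norm_num
  refine linearIndependent_triple_of_three_descent F_no_three_torsion _ _ _
    ?_ ?_ ?_ ?_ ?_ ?_ ?_ ?_ ?_ ?_ ?_ ?_ ?_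
  · exact not_three_dvd_of_cert r7 d7 (by rw [card_F_7, h7a]; exact c100)
  · exact not_three_dvd_of_cert r7 d7 (by rw [card_F_7, h7b]; exact c010)
  · exact not_three_dvd_of_cert r7 d7 (by rw [card_F_7, h7c]; exact c001)
  · exact not_three_dvd_of_cert r7 d7 (by rw [card_F_7, map_add, h7a, h7b]; exact c110)
  · exact not_three_dvd_of_cert r11 d11 (by rw [card_F_11, map_add, map_nsmul, h11a, h11b]; exact c120)
  · exact not_three_dvd_of_cert r11 d11 (by rw [card_F_11, map_add, h11a, h11c]; exact c101)
  · exact not_three_dvd_of_cert r7 d7 (by rw [card_F_7, map_add, map_nsmul, h7a, h7c]; exact c102)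
  · exact not_three_dvd_of_cert r11 d11 (by rw [card_F_11, map_add, h11b, h11c]; exact c011)
  · exact not_three_dvd_of_cert r7 d7 (by rw [card_F_7, map_add, map_nsmul, h7b, h7c]; exact c012)
  · exact not_three_dvd_of_cert r7 d7 (by rw [card_F_7, map_add, map_add, h7a, h7b, h7c]; exact c111)
  · exact not_three_dvd_of_cert r29 d29 (by rw [card_F_29, map_add, map_add, map_nsmul, h29a, h29b, h29c]; exact c112)
  · exact not_three_dvd_of_cert r7 d7 (by rw [card_F_7, map_add, map_add, map_nsmul, h7a, h7b, h7c]; exact c121)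
  · exact not_three_dvd_of_cert r7 d7 (by rw [card_F_7, map_add, map_add, map_nsmul, map_nsmul, h7a, h7b, h7c]; exact c122)

/-- **`3 ≤ rank F(ℚ)`** (Mordell–Weil + three independent points). [cite: SilvermanAEC2009, Thm. VIII.6.7] -/
theorem three_le_rank_F : 3 ≤ (⟨0, 0, 1, -651, 6502⟩ : WeierstrassCurve ℚ).mordellWeilRank := by
  rw [← F_map_eq]
  haveI : ((⟨0, 0, 1, -651, 6502⟩ : WeierstrassCurve ℤ).map (Int.castRingHom ℚ)).IsElliptic := ⟨isUnit_iff_ne_zero.mpr F_map_Δ_ne_zero⟩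
  refine three_le_mordellWeilRank_of_linearIndependent _ (module_finite_point_holds _)
    (P := .some _ _ nonsingular_P₁) (Q := .some _ _ nonsingular_P₂) (R := .some _ _ nonsingular_P₃) ?_
  convert F_linearIndependent

end Visible441099r1

end Summit.BirchSwinnertonDyer.BirchSwinnertonDyer.Theorems

end
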